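import Summits.KontsevichZagierPeriods.KontsevichZagierPeriods.Theorems.SoloInformedAnFibre
import Mathlib.RingTheory.UniqueFactorizationDomain.GCDMonoid
import Mathlib.RingTheory.UniqueFactorizationDomain.Multiplicity
import Mathlib.RingTheory.Polynomial.UniqueFactorization
import Mathlib.Algebra.MvPolynomial.NoZeroDivisors
import HarnessLib

/-!
# The DEN-calculus over `K`: RED — reduction to finitely many zeros of the denominator

Solo programme `solo-KontsevichZagierPeriods-informed`, session s108, step 5 of THEOREM 2D⁺.

**RED** (`soloInformed_reduce_dim2`).  Let `P, Q ∈ K[x₀, x₁]` and suppose the (junk-valued) quotient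
`P/Q` is absolutely integrable on the open square `U = (0,1)²`.  Then there are `P₁, Q₁, N` with
`N ≠ 0`, `P/Q = P₁/Q₁` wherever `N ≠ 0`, and `Q₁` has only finitely many zeros in `U`.

Proof.  `Q = 0` is trivial (`P/0 = 0 = 0/1`).  Otherwise cancel `G = gcd(P, Q)`: `P = G P₁`,
`Q = G Q₁`, `N = G`, and no irreducible factor of `Q₁` divides `P₁`.  If `Q₁` had infinitely many
zeros in `U`, some irreducible factor `q` of `Q₁` would (`soloInformed_exists_irreducible_factor_infinite_zeros`);
write `Q₁ = qᵏ m`, `q ∤ m`, `k ≥ 1`.  `q` is not constant, so some `∂ᵢ q ≠ 0`, and `q ∤ ∂ᵢ q` (degree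
in `xᵢ`); after the coordinate swap, `i = 1`.  By ELIM the common zeros of `q` with `P₁`, `∂₁q`, `m`
are finite, so some zero `z₀ ∈ U` of `q` avoids them, and NONINT shows `P₁/(qᵏ m) = P₁/Q₁` is not
integrable on `U`; but `P/Q = P₁/Q₁` almost everywhere on `U` (off the null zero set of `G`, NULL) —
contradiction.

References: Kontsevich–Zagier 2001 §1.1; Bochnak–Coste–Roy 1998 §1.2.
-/

noncomputable section

open scoped BigOperators Topology
open MeasureTheory Set Filter
open Literature.NumberTheory.Transcendental Literature.NumberTheory.Transcendental.KZ

namespace Summit.KontsevichZagierPeriods.KontsevichZagierPeriods.Theorems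

variable {K : Type*} [Field K] [Algebra K ℝ] {n : ℕ}

/-! ## Algebraic preliminaries -/

/-- A non-zero polynomial with infinitely many zeros in the open square has an irreducible factor
with infinitely many zeros in the open square. [this work] -/
theorem soloInformed_exists_irreducible_factor_infinite_zeros {F : MvPolynomial (Fin 2) K}
    (hF : F ≠ 0)
    (hinf : {x | x ∈ soloInformedOpenCube 2 ∧ (MvPolynomial.aeval x F : ℝ) = 0}.Infinite) :
    ∃ q : MvPolynomial (Fin 2) K, Irreducible q ∧ q ∣ F ∧
      {x | x ∈ soloInformedOpenCube 2 ∧ (MvPolynomial.aeval x q : ℝ) = 0}.Infinite := by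
  induction F using WfDvdMonoid.induction_on_irreducible with
  | zero => exact absurd rfl hF
  | unit u hu =>
    exfalso
    obtain ⟨x, -, hx⟩ := hinf.nonempty
    exact (hu.map (MvPolynomial.aeval x)).ne_zero hx
  | mul a i ha hi ih =>
    have hunion : {x | x ∈ soloInformedOpenCube 2 ∧ (MvPolynomial.aeval x (i * a) : ℝ) = 0} =
        {x | x ∈ soloInformedOpenCube 2 ∧ (MvPolynomial.aeval x i : ℝ) = 0} ∪
          {x | x ∈ soloInformedOpenCube 2 ∧ (MvPolynomial.aeval x a : ℝ) = 0} := by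
      ext x
      simp only [map_mul, mul_eq_zero, mem_setOf_eq, mem_union]
      tauto
    rw [hunion, Set.infinite_union] at hinf
    rcases hinf with h | h
    · exact ⟨i, hi, dvd_mul_right i a, h⟩
    · obtain ⟨q, hq, hqa, hqinf⟩ := ih ha h
      exact ⟨q, hq, hqa.trans (dvd_mul_left a i), hqinf⟩

/-- A polynomial of positive total degree over a field of characteristic zero has a non-zero
partial derivative. [this work] -/
theorem soloInformed_exists_pderiv_ne_zero {q : MvPolynomial (Fin n) K} (hq : q.totalDegree ≠ 0) :
    ∃ i, MvPolynomial.pderiv i q ≠ 0 := by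
  classical
  haveI : CharZero K := soloInformed_charZero_of_embedding K
  have hq0 : q ≠ 0 := fun h => hq (by rw [h, MvPolynomial.totalDegree_zero])
  have hne : q.support.Nonempty := by
    rw [Finset.nonempty_iff_ne_empty, Ne, MvPolynomial.support_eq_empty]; exact hq0
  obtain ⟨a, ha, hsup⟩ := Finset.exists_mem_eq_sup q.support hne (fun s => s.sum fun _ e => e)
  have ha0 : a ≠ 0 := fun h => by
    apply hq
    rw [MvPolynomial.totalDegree, hsup, h, Finsupp.sum_zero_index]
  obtain ⟨i, hi⟩ : ∃ i, a i ≠ 0 := by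
    by_contra h
    push Not at h
    exact ha0 (Finsupp.ext fun j => by simpa using h j)
  refine ⟨i, MvPolynomial.ne_zero_iff.2 ⟨a - Finsupp.single i 1, ?_⟩⟩
  have hle : Finsupp.single i 1 ≤ a := Finsupp.single_le_iff.2 (Nat.one_le_iff_ne_zero.2 hi)
  rw [MvPolynomial.coeff_pderiv, tsub_add_cancel_of_le hle]
  exact mul_ne_zero (MvPolynomial.mem_support_iff.1 ha) (Nat.cast_add_one_ne_zero _)

omit [Algebra K ℝ] in
/-- The degree in `xᵢ` drops under `∂ᵢ` (when `∂ᵢ q ≠ 0`). [this work] -/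
theorem soloInformed_degreeOf_pderiv_lt {q : MvPolynomial (Fin n) K} {i : Fin n}
    (h : MvPolynomial.pderiv i q ≠ 0) :
    MvPolynomial.degreeOf i (MvPolynomial.pderiv i q) < MvPolynomial.degreeOf i q := by
  classical
  obtain ⟨m₀, hm₀⟩ := MvPolynomial.ne_zero_iff.1 h
  have key : ∀ m, MvPolynomial.coeff m (MvPolynomial.pderiv i q) ≠ 0 →
      m i + 1 ≤ MvPolynomial.degreeOf i q := fun m hm => by
    rw [MvPolynomial.coeff_pderiv] at hm
    have hm' : MvPolynomial.coeff (m + Finsupp.single i 1) q ≠ 0 := left_ne_zero_of_mul hm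
    have := MvPolynomial.monomial_le_degreeOf i (MvPolynomial.mem_support_iff.2 hm')
    simpa [Finsupp.add_apply, Finsupp.single_eq_same] using this
  have hpos : 0 < MvPolynomial.degreeOf i q := lt_of_lt_of_le (Nat.succ_pos _) (key m₀ hm₀)
  rw [MvPolynomial.degreeOf_lt_iff hpos]
  intro m hm
  exact lt_of_lt_of_le (Nat.lt_succ_self _) (key m (MvPolynomial.mem_support_iff.1 hm))

omit [Algebra K ℝ] in
/-- A non-zero polynomial of smaller degree in `xᵢ` is not a multiple. [this work] -/
theorem soloInformed_not_dvd_of_degreeOf_lt {q H : MvPolynomial (Fin n) K} {i : Fin n} (hH : H ≠ 0)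
    (hlt : MvPolynomial.degreeOf i H < MvPolynomial.degreeOf i q) : ¬q ∣ H := by
  rintro ⟨r, rfl⟩
  have hq : q ≠ 0 := left_ne_zero_of_mul hH
  have hr : r ≠ 0 := right_ne_zero_of_mul hH
  rw [MvPolynomial.degreeOf_mul_eq hq hr] at hlt
  omega

/-! ## The swap and integrability -/

/-- Integrability on the open square is invariant under the coordinate swap. [this work] -/
theorem soloInformed_integrableOn_comp_swap {g : (Fin 2 → ℝ) → ℝ}
    (hg : IntegrableOn g (soloInformedOpenCube 2)) :
    IntegrableOn (g ∘ fun x : Fin 2 → ℝ => (![x 1, x 0] : Fin 2 → ℝ)) (soloInformedOpenCube 2) := by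
  set s : (Fin 2 → ℝ) ≃ᵐ (Fin 2 → ℝ) :=
    ((MeasurableEquiv.finTwoArrow (α := ℝ)).trans MeasurableEquiv.prodComm).trans
      (MeasurableEquiv.finTwoArrow (α := ℝ)).symm with hs_def
  have hs : ∀ x : Fin 2 → ℝ, s x = ![x 1, x 0] := fun x => by
    funext i
    fin_cases i <;> simp [hs_def, MeasurableEquiv.finTwoArrow, MeasurableEquiv.prodComm]
  have h2 : MeasurePreserving (Prod.swap : ℝ × ℝ → ℝ × ℝ) volume volume :=
    Measure.measurePreserving_swap
  have hmp : MeasurePreserving s volume volume :=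
    (MeasurePreserving.symm _ (volume_preserving_finTwoArrow ℝ)).comp
      (h2.comp (volume_preserving_finTwoArrow ℝ))
  have hpre : s ⁻¹' soloInformedOpenCube 2 = soloInformedOpenCube 2 := by
    ext x
    rw [mem_preimage, hs]
    constructor
    · intro hx
      have h := soloInformed_swap_mem_openCube hx
      have hxx : (![(![x 1, x 0] : Fin 2 → ℝ) 1, (![x 1, x 0] : Fin 2 → ℝ) 0] : Fin 2 → ℝ) = x := by
        funext j; fin_cases j <;> rfl
      rwa [hxx] at h
    · exact fun hx => soloInformed_swap_mem_openCube hx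
  have hfun : (g ∘ fun x : Fin 2 → ℝ => (![x 1, x 0] : Fin 2 → ℝ)) = g ∘ s := by
    funext x; simp only [Function.comp_apply, hs]
  rw [hfun, ← hpre]
  exact (hmp.integrableOn_comp_preimage s.measurableEmbedding).2 (hpre.symm ▸ hg)

/-! ## Non-integrability along a curve of zeros -/

/-- The measurable open square. -/
theorem soloInformed_isOpen_openCube (m : ℕ) : IsOpen (soloInformedOpenCube m) := by
  rw [soloInformedOpenCube_eq_pi]; exact isOpen_set_pi finite_univ fun _ _ => isOpen_Ioo

/-- **INNER.**  `q` irreducible with infinitely many zeros on the open square, `q ∤ P`, `q ∤ m`,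
`∂₁q ≠ 0`, `k ≥ 1` `⇒` `P/(qᵏ m)` is not integrable on the open square. [this work] -/
theorem soloInformed_not_integrableOn_curve {q P m : MvPolynomial (Fin 2) K} {k : ℕ}
    (hq : Irreducible q) (hqP : ¬q ∣ P) (hqm : ¬q ∣ m) (hk : k ≠ 0)
    (hH : MvPolynomial.pderiv 1 q ≠ 0)
    (hinf : {x | x ∈ soloInformedOpenCube 2 ∧ (MvPolynomial.aeval x q : ℝ) = 0}.Infinite) :
    ¬IntegrableOn (fun x => (MvPolynomial.aeval x P : ℝ) / MvPolynomial.aeval x (q ^ k * m))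
      (soloInformedOpenCube 2) := by
  have hqH : ¬q ∣ MvPolynomial.pderiv 1 q :=
    soloInformed_not_dvd_of_degreeOf_lt hH (soloInformed_degreeOf_pderiv_lt hH)
  have hfin : ({x : Fin 2 → ℝ | (MvPolynomial.aeval x q : ℝ) = 0 ∧ (MvPolynomial.aeval x P : ℝ) = 0} ∪
      {x | (MvPolynomial.aeval x q : ℝ) = 0 ∧
        (MvPolynomial.aeval x (MvPolynomial.pderiv 1 q) : ℝ) = 0} ∪
      {x | (MvPolynomial.aeval x q : ℝ) = 0 ∧ (MvPolynomial.aeval x m : ℝ) = 0}).Finite :=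
    ((soloInformed_finite_commonZeros hq hqP).union (soloInformed_finite_commonZeros hq hqH)).union
      (soloInformed_finite_commonZeros hq hqm)
  obtain ⟨z₀, ⟨hz₀U, hz₀q⟩, hz₀F⟩ := (hinf.sdiff hfin).nonempty
  simp only [mem_union, mem_setOf_eq, not_or, not_and] at hz₀F
  obtain ⟨⟨hP0, hH0⟩, hm0⟩ := hz₀F
  exact soloInformed_not_integrableOn_of_curveZero P q m hk (soloInformed_isOpen_openCube 2) hz₀U
    hz₀q (hH0 hz₀q) (hm0 hz₀q) (hP0 hz₀q)

/-- **INNER, swapped.**  The same with `∂₀q ≠ 0`, by the coordinate swap. [this work] -/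
theorem soloInformed_not_integrableOn_curve_swap {q P m : MvPolynomial (Fin 2) K} {k : ℕ}
    (hq : Irreducible q) (hqP : ¬q ∣ P) (hqm : ¬q ∣ m) (hk : k ≠ 0)
    (hH : MvPolynomial.pderiv 0 q ≠ 0)
    (hinf : {x | x ∈ soloInformedOpenCube 2 ∧ (MvPolynomial.aeval x q : ℝ) = 0}.Infinite) :
    ¬IntegrableOn (fun x => (MvPolynomial.aeval x P : ℝ) / MvPolynomial.aeval x (q ^ k * m))
      (soloInformedOpenCube 2) := by
  intro hint
  have hq' : Irreducible (soloInformedSwapK q) := by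
    rw [soloInformed_swapK_eq_renameEquiv]; exact (MulEquiv.irreducible_iff _).2 hq
  have hdvd : ∀ {a b : MvPolynomial (Fin 2) K}, soloInformedSwapK a ∣ soloInformedSwapK b → a ∣ b :=
    fun h => by
      rw [soloInformed_swapK_eq_renameEquiv, soloInformed_swapK_eq_renameEquiv] at h
      exact (map_dvd_iff _).1 h
  have hH' : MvPolynomial.pderiv 1 (soloInformedSwapK q) ≠ 0 := by
    have h := MvPolynomial.pderiv_rename (Equiv.swap (0 : Fin 2) 1).injective 0 q
    rw [Equiv.swap_apply_left] at h
    change MvPolynomial.pderiv 1 (MvPolynomial.rename (Equiv.swap (0 : Fin 2) 1) q) ≠ 0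
    rw [h]
    intro h0
    apply hH
    have h1 := congrArg soloInformedSwapK h0
    rw [map_zero] at h1
    rw [← h1]
    exact (soloInformed_swapK_swapK _).symm
  have hxx : ∀ x : Fin 2 → ℝ,
      (![(![x 1, x 0] : Fin 2 → ℝ) 1, (![x 1, x 0] : Fin 2 → ℝ) 0] : Fin 2 → ℝ) = x := fun x => by
    funext j; fin_cases j <;> rfl
  have hinf' : {x | x ∈ soloInformedOpenCube 2 ∧
      (MvPolynomial.aeval x (soloInformedSwapK q) : ℝ) = 0}.Infinite := by
    have hsub : {x | x ∈ soloInformedOpenCube 2 ∧ (MvPolynomial.aeval x q : ℝ) = 0} ⊆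
        range (fun x : Fin 2 → ℝ => (![x 1, x 0] : Fin 2 → ℝ)) :=
      fun x _ => ⟨![x 1, x 0], hxx x⟩
    have heq : {x | x ∈ soloInformedOpenCube 2 ∧
        (MvPolynomial.aeval x (soloInformedSwapK q) : ℝ) = 0} =
        (fun x : Fin 2 → ℝ => (![x 1, x 0] : Fin 2 → ℝ)) ⁻¹'
          {x | x ∈ soloInformedOpenCube 2 ∧ (MvPolynomial.aeval x q : ℝ) = 0} := by
      ext x
      simp only [mem_preimage, mem_setOf_eq, soloInformed_aeval_swapK]
      constructor
      · rintro ⟨hx, h⟩; exact ⟨soloInformed_swap_mem_openCube hx, h⟩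
      · rintro ⟨hx, h⟩
        refine ⟨?_, h⟩
        have h' := soloInformed_swap_mem_openCube hx
        rwa [hxx] at h'
    rw [heq]; exact hinf.preimage hsub
  have hint' : IntegrableOn (fun x => (MvPolynomial.aeval x (soloInformedSwapK P) : ℝ) /
      MvPolynomial.aeval x (soloInformedSwapK q ^ k * soloInformedSwapK m)) (soloInformedOpenCube 2) := by
    have hfun : (fun x : Fin 2 → ℝ => (MvPolynomial.aeval x (soloInformedSwapK P) : ℝ) /
        MvPolynomial.aeval x (soloInformedSwapK q ^ k * soloInformedSwapK m)) =
        (fun x => (MvPolynomial.aeval x P : ℝ) / MvPolynomial.aeval x (q ^ k * m)) ∘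
          fun x : Fin 2 → ℝ => (![x 1, x 0] : Fin 2 → ℝ) := by
      funext x
      simp only [Function.comp_apply, ← map_pow, ← map_mul, soloInformed_aeval_swapK]
    rw [hfun]
    exact soloInformed_integrableOn_comp_swap hint
  exact soloInformed_not_integrableOn_curve hq' (fun h => hqP (hdvd h)) (fun h => hqm (hdvd h)) hk
    hH' hinf' hint'

/-- **OUTER.**  If `Q ≠ 0`, no irreducible factor of `Q` divides `P`, and `Q` has infinitely many
zeros on the open square, then `P/Q` is not integrable on the open square. [this work] -/
theorem soloInformed_not_integrableOn_of_infinite_zeros {P Q : MvPolynomial (Fin 2) K} (hQ : Q ≠ 0)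
    (hcop : ∀ q : MvPolynomial (Fin 2) K, Irreducible q → q ∣ Q → ¬q ∣ P)
    (hinf : {x | x ∈ soloInformedOpenCube 2 ∧ (MvPolynomial.aeval x Q : ℝ) = 0}.Infinite) :
    ¬IntegrableOn (fun x => (MvPolynomial.aeval x P : ℝ) / MvPolynomial.aeval x Q)
      (soloInformedOpenCube 2) := by
  obtain ⟨q, hq, hqQ, hqinf⟩ := soloInformed_exists_irreducible_factor_infinite_zeros hQ hinf
  have hqP := hcop q hq hqQ
  obtain ⟨k, m, hqm, hQeq⟩ := WfDvdMonoid.max_power_factor hQ hq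
  have hk : k ≠ 0 := by
    rintro rfl
    rw [pow_zero, one_mul] at hQeq
    exact hqm (hQeq ▸ hqQ)
  have hdeg : q.totalDegree ≠ 0 := by
    intro h0
    obtain ⟨x, -, hx⟩ := hqinf.nonempty
    rw [MvPolynomial.totalDegree_eq_zero_iff_eq_C] at h0
    rw [h0, MvPolynomial.aeval_C] at hx
    have hc : MvPolynomial.coeff 0 q = 0 := (map_eq_zero_iff _ (algebraMap K ℝ).injective).1 hx
    exact hq.ne_zero (by rw [h0, hc, map_zero])
  obtain ⟨i, hi⟩ := soloInformed_exists_pderiv_ne_zero hdeg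
  rw [hQeq]
  fin_cases i
  · exact soloInformed_not_integrableOn_curve_swap hq hqP hqm hk hi hqinf
  · exact soloInformed_not_integrableOn_curve hq hqP hqm hk hi hqinf

/-! ## RED -/

/-- **RED.**  If `P/Q` (junk value `0` where `Q = 0`) is absolutely integrable on the open square,
then `P/Q = P₁/Q₁` off the zero set of some `N ≠ 0`, with `Q₁` having only finitely many zeros on
the open square (`P₁ = P/gcd`, `Q₁ = Q/gcd`, `N = gcd(P,Q)`). [this work] -/
theorem soloInformed_reduce_dim2 (P Q : MvPolynomial (Fin 2) K)
    (hint : IntegrableOn (fun x => (MvPolynomial.aeval x P : ℝ) / MvPolynomial.aeval x Q)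
      (soloInformedOpenCube 2)) :
    ∃ P₁ Q₁ N : MvPolynomial (Fin 2) K, N ≠ 0 ∧
      (∀ x : Fin 2 → ℝ, (MvPolynomial.aeval x N : ℝ) ≠ 0 →
        (MvPolynomial.aeval x P : ℝ) / MvPolynomial.aeval x Q =
          MvPolynomial.aeval x P₁ / MvPolynomial.aeval x Q₁) ∧
      {x | x ∈ soloInformedOpenCube 2 ∧ (MvPolynomial.aeval x Q₁ : ℝ) = 0}.Finite := by
  classical
  by_cases hQ : Q = 0
  · refine ⟨0, 1, 1, one_ne_zero, fun x _ => by simp [hQ], ?_⟩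
    simp
  letI := UniqueFactorizationMonoid.toGCDMonoid (MvPolynomial (Fin 2) K)
  set G : MvPolynomial (Fin 2) K := gcd P Q with hGdef
  obtain ⟨P', hP'⟩ : G ∣ P := gcd_dvd_left P Q
  obtain ⟨Q', hQ'⟩ : G ∣ Q := gcd_dvd_right P Q
  have hG : G ≠ 0 := fun h => hQ (by rw [hQ', h, zero_mul])
  have hQ'0 : Q' ≠ 0 := fun h => hQ (by rw [hQ', h, mul_zero])
  have hcop : ∀ q : MvPolynomial (Fin 2) K, Irreducible q → q ∣ Q' → ¬q ∣ P' :=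
    fun q hq hqQ hqP => hq.not_isUnit (by
      have h1 : G * q ∣ P := by
        conv_rhs => rw [hP']
        exact mul_dvd_mul_left _ hqP
      have h2 : G * q ∣ Q := by
        conv_rhs => rw [hQ']
        exact mul_dvd_mul_left _ hqQ
      have h3 : G * q ∣ G * 1 := by rw [mul_one]; exact dvd_gcd h1 h2
      exact isUnit_of_dvd_one ((mul_dvd_mul_iff_left hG).1 h3))
  have hmeas : MeasurableSet (soloInformedOpenCube 2) := by
    rw [soloInformedOpenCube_eq_pi]; exact MeasurableSet.univ_pi fun _ => measurableSet_Ioo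
  have hval : ∀ x : Fin 2 → ℝ, (MvPolynomial.aeval x G : ℝ) ≠ 0 →
      (MvPolynomial.aeval x P : ℝ) / MvPolynomial.aeval x Q =
        MvPolynomial.aeval x P' / MvPolynomial.aeval x Q' := fun x hx => by
    rw [hP', hQ', map_mul, map_mul, mul_div_mul_left _ _ hx]
  refine ⟨P', Q', G, hG, hval, ?_⟩
  by_contra hinf
  have hae : (fun x => (MvPolynomial.aeval x P : ℝ) / MvPolynomial.aeval x Q) =ᵐ[volume.restrict
      (soloInformedOpenCube 2)]
      (fun x => (MvPolynomial.aeval x P' : ℝ) / MvPolynomial.aeval x Q') := by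
    have hnull := soloInformed_volume_zeroSet_openCube hG
    rw [Filter.EventuallyEq, ae_restrict_iff' hmeas, ae_iff]
    refine measure_mono_null (fun x hx => ?_) hnull
    rw [mem_setOf_eq, Classical.not_imp] at hx
    obtain ⟨hxU, hne⟩ := hx
    refine ⟨hxU, ?_⟩
    by_contra hGx
    exact hne (hval x hGx)
  exact soloInformed_not_integrableOn_of_infinite_zeros hQ'0 hcop hinf (hint.congr_fun_ae hae)

end Summit.KontsevichZagierPeriods.KontsevichZagierPeriods.Theorems
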